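/-
Copyright (c) 2026 the pub-hodgecm-mathlib formalisation cell (harness21).  Prover seat hodgecm-mathlib-K2Liu-p13 (g2), Track B «K2-LIT»,
#184♮ = hLiu418 = `stmt-HodgeConjecture-24832`; Road I v3 organ U1-CT-ind STAGE 2 (Q2), file F5-e (LEAD F0P6-plan (g14) 10:39:33Z ∕ 11:15:51Z «F4 → F5 → D-U1 stage 3 =»).
-/
import Summits.HodgeConjecture.HodgeConjecture.Theorems.K2LiuKlingenInnerSectionLeviLaw   -- ★ F5-c: `apply_transport_weylXi_conj_uPlus_mul` (+ ★ F4-1)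
import Literature.MeasureTheory.Group.CoveringWeights
import Mathlib.MeasureTheory.Integral.Prod
import HarnessLib

/-!
# Crux `HLiu418`, Road I v3, organ U1 stage 2 (Q2), file F5-e: INTEGRATING A COMPACT FIBRE OUT OF A WEIGHTED INTEGRAL —
# `∫ β₁(u) • φ(u) dνN = vol · ∫ g dμ` when `νN = Φ_*(μ_Z × μ)`, `φ ∘ Φ` depends only on the second coordinate and `β₁` has constant fibre mass;
# the `u₊(L⁺)\u₊(𝔸)`-integration of the inner section of the `ξ`-cell (payer of ★ F5-c's `hF`)

Cell `hodgecm-mathlib`, crux item hLiu418 = `stmt-HodgeConjecture-24832`; squad K2 ∕ K2Liu; LEAD F0P6-plan (g14), co-dealer K2E5-plan (g7); prover K2Liu-p13 (g2).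
THEOREMS ONLY (no `def`, no instance, no notation, no named-fact hypothesis, no `sorry`); lane `--supports stmt-HodgeConjecture-24832 --as helper` (count-neutral).
WHY.  ★ F4-2c ∕ F5-a express the `ξ`-cell of the Q-constant term through `F(x) = ∫ β₁(u) • f(Ψ(ξ) u x) dνN(u)` over `N_Q(𝔸)` with `β₁` a `Ψ(u₊(L⁺))`-covering weight;
★ F5-c's Klingen-Levi law consumes `F(x) = ∫ f(Ψ(ξ) · Ψ(n_Q(y_p,0,t_p)) · x) dμ(p)` (hypothesis `hF`).  The passage is «integrate out the compact `u₊(L⁺)\u₊(𝔸)`»: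
`N_Q(𝔸) = u₊(𝔸) · (u_{2e₁}·u_{e₁−e₂})(𝔸)` (★ F5-c `nKlingen_eq_uPlus_mul`), `f(Ψ(ξ) u₊(z) n′ x) = f(Ψ(ξ) n′ x)` (★ F5-c `apply_transport_weylXi_conj_uPlus_mul`), and the fibre
mass `∫_{u₊(𝔸)} β₁(u₊(z) n′) dz` is the SAME for every `n′` (covering-weight independence on the fibre).  Typed here GENERICALLY, with the product structure of `νN`
BY VALUE (`νN = Φ_*(μ_Z × μ)` — the Haar measure of the Heisenberg group `N_Q(𝔸)` is the product measure in the coordinates `(z; y, t)`; a bookkeeping owed by the consumer's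
instantiation of `νN`, as for ★ O41.4's `νN`):
* §1 **`integral_prod_wt_smul_eq_of_lintegral_fibre_eq`** — Fubini (`integral_prod_symm`) + constant fibre mass `∫⁻ W(·,p) dμ_Z = C`: `∫ W • (g ∘ snd) d(μ_Z × μ) = C · ∫ g dμ`.
* §2 **`lintegral_fibre_eq_of_coveringSum_eq_one`** — the fibre mass IS constant when each fibre weight `W(·, p)` is a covering weight for one countable group `Γ` acting on
  `Z` preserving `μ_Z` (★ `Literature.MeasureTheory.Group.CoveringWeights.lintegral_mul_eq_of_coveringSum_eq` with `F = 1`).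
* §3 **`integral_wt_smul_eq_mul_integral_fibre`** — for ANY subgroup `Nsub ≤ H(𝔸)` with `νN = Φ_*(μ_Z × μ)`, `β₁ ∘ Φ` of constant fibre mass `C` and `φ ∘ Φ = g ∘ snd`:
  `∫ β₁(u) • φ(u) dνN = C · ∫ g dμ`.
* §4 (`n = 2`, ★ F3 clauses BY VALUE) **`klingenInner_eq_mul_integral_fibre`** — the Klingen instance: `φ(u) = f(Ψ(ξ) u x)`, `Φ(z,p) = Ψ(u₊(z)) · Ψ(n_Q(y_p, 0, t_p))` (as elements of
  `N_Q(𝔸)`), so `∫ β₁(u) • f(Ψ(ξ) u x) dνN = C · ∫ f(Ψ(ξ) · Ψ(n_Q(y_p,0,t_p)) · x) dμ(p)` — ★ F5-c's `hF` with `F := C⁻¹ • (★ F5-a's orbit value)`.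
[MoeglinWaldspurger1995, II.1.7], [GanTakeda2011SiegelWeil, §7.2 p. 23], [Weil1965, §9], [CogdellAnalyticTheory2004, §2.3].
HONEST LABEL.  Count-neutral helper: `HC_CM` is proved only modulo the 7 printed citations (2 remaining named inputs: hLiu418 = `stmt-HodgeConjecture-24832`,
h413 = `stmt-HodgeConjecture-24833`) until rung 0 closes.
-/

set_option autoImplicit false
set_option linter.dupNamespace false -- the mandated namespace repeats `HodgeConjecture.HodgeConjecture`

noncomputable section

open scoped Matrix ENNReal NNReal
open NumberField IsDedekindDomain MeasureTheory MeasureTheory.Measure Filter Set Function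

namespace Summit.HodgeConjecture.HodgeConjecture.Cruxes.HLiu418.K2LiuCoveringWeightFibreIntegration

open Literature.MeasureTheory.Group

/-! ## §1 Fubini with constant fibre mass -/

/-- **FUBINI WITH CONSTANT FIBRE MASS**: `W : Z × P → [0,∞]` measurable with `∫⁻ W(z,p) dμ_Z(z) = C < ∞` for every `p`, `g : P → ℂ`, and the weighted function
`(z,p) ↦ W(z,p) • g(p)` integrable for `μ_Z × μ` ⇒ `∫ W(z,p) • g(p) d(μ_Z × μ) = C · ∫ g dμ`. [cite: CogdellAnalyticTheory2004, §2.3] -/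
theorem integral_prod_wt_smul_eq_of_lintegral_fibre_eq {Z P : Type*} [MeasurableSpace Z] [MeasurableSpace P] (μZ : Measure Z) (μ : Measure P)
    [SFinite μZ] [SFinite μ] {W : Z × P → ℝ≥0∞} (hWm : Measurable W) {C : ℝ≥0∞} (hC : C ≠ ∞) (hfib : ∀ p, ∫⁻ z, W (z, p) ∂μZ = C)
    (g : P → ℂ) (hint : Integrable (fun zp : Z × P => (W zp).toReal • g zp.2) (μZ.prod μ)) :
    ∫ zp, (W zp).toReal • g zp.2 ∂(μZ.prod μ) = C.toReal * ∫ p, g p ∂μ := by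
  rw [integral_prod_symm _ hint]
  have hinner : ∀ p, ∫ z, (W (z, p)).toReal • g p ∂μZ = C.toReal • g p := by
    intro p
    have hWp : Measurable fun z => W (z, p) := hWm.comp (measurable_id.prodMk measurable_const)
    rw [integral_smul_const]
    congr 1
    rw [show (∫ z, (W (z, p)).toReal ∂μZ) = (∫⁻ z, W (z, p) ∂μZ).toReal from
      integral_toReal hWp.aemeasurable (ae_lt_top hWp (by rw [hfib p]; exact hC)), hfib p]
  simp_rw [hinner]
  rw [integral_smul, Complex.real_smul]

/-! ## §2 Constant fibre mass from covering weights on the fibre -/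

/-- **THE FIBRE MASS OF A FAMILY OF COVERING WEIGHTS IS CONSTANT**: a countable group `Γ` acting measurably on `Z` preserving `μ_Z`; if every fibre weight `W(·, p)` is
measurable with covering sum `Σ_γ W(γ • z, p) = 1`, then `∫⁻ W(·, p) dμ_Z = ∫⁻ W(·, p₀) dμ_Z` (independence of the weight, ★ `lintegral_mul_eq_of_coveringSum_eq` with `F = 1`).
[cite: Weil1965, §9] [cite: CogdellAnalyticTheory2004, §2.3] -/
theorem lintegral_fibre_eq_of_coveringSum_eq_one {Γ : Type*} [Group Γ] [Countable Γ] {Z : Type*} [MulAction Γ Z] [MeasurableSpace Z] [MeasurableConstSMul Γ Z]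
    (μZ : Measure Z) [SMulInvariantMeasure Γ Z μZ] {P : Type*} {W : Z × P → ℝ≥0∞} (hWm : ∀ p, Measurable fun z => W (z, p))
    (hcov : ∀ p z, coveringSum Γ (fun z' => W (z', p)) z = 1) (p p₀ : P) :
    ∫⁻ z, W (z, p) ∂μZ = ∫⁻ z, W (z, p₀) ∂μZ := by
  have h := lintegral_mul_eq_of_coveringSum_eq μZ (F := fun _ => (1 : ℝ≥0∞)) measurable_const (fun _ _ => rfl) (hWm p) (hWm p₀) one_ne_zero
    ENNReal.one_ne_top (hcov p) (hcov p₀)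
  simpa only [one_mul] using h

/-! ## §3 Integrating the fibre out of a weighted integral on a subgroup `Nsub ≤ H(𝔸)` with product-structured measure -/

/-- **`∫ β₁ • φ dνN = C · ∫ g dμ`** when `νN = Φ_*(μ_Z × μ)` (product structure of the measure, BY VALUE), `β₁ ∘ Φ` has constant fibre mass `C < ∞`, and `φ ∘ Φ = g ∘ snd`
(the integrand is invariant along the fibres); integrability of `β₁ • φ` for `νN` is transported to the product. Generic in all types.
[cite: MoeglinWaldspurger1995, II.1.7] [cite: Weil1965, §9] -/
theorem integral_wt_smul_eq_mul_integral_fibre {N : Type*} [MeasurableSpace N] (νN : Measure N)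
    {Z P : Type*} [MeasurableSpace Z] [MeasurableSpace P] (μZ : Measure Z) (μ : Measure P) [SFinite μZ] [SFinite μ]
    (Φ : Z × P → N) (hΦ : Measurable Φ) (hνN : νN = (μZ.prod μ).map Φ)
    {β₁ : N → ℝ≥0∞} (hβm : Measurable β₁) {C : ℝ≥0∞} (hC : C ≠ ∞) (hfib : ∀ p, ∫⁻ z, β₁ (Φ (z, p)) ∂μZ = C)
    {φ : N → ℂ} (hφm : AEStronglyMeasurable φ νN) (g : P → ℂ) (hφ : ∀ zp, φ (Φ zp) = g zp.2)
    (hint : Integrable (fun u => (β₁ u).toReal • φ u) νN) :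
    ∫ u, (β₁ u).toReal • φ u ∂νN = C.toReal * ∫ p, g p ∂μ := by
  have hfm : AEStronglyMeasurable (fun u => (β₁ u).toReal • φ u) νN := hβm.ennreal_toReal.aestronglyMeasurable.smul hφm
  subst hνN
  rw [integral_map hΦ.aemeasurable hfm]
  have hint' : Integrable (fun zp : Z × P => (β₁ (Φ zp)).toReal • φ (Φ zp)) (μZ.prod μ) := (integrable_map_measure hfm hΦ.aemeasurable).1 hint
  simp_rw [hφ] at hint' ⊢
  exact integral_prod_wt_smul_eq_of_lintegral_fibre_eq μZ μ (W := fun zp => β₁ (Φ zp)) (hβm.comp hΦ) hC hfib g hint'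

/-! ## §4 The Klingen instance: the `u₊`-integration of the inner section of the `ξ`-cell (`n = 2`) -/

open Literature.NumberTheory.Automorphic Literature.NumberTheory.Automorphic.UnitaryGroup
open Literature.NumberTheory.GelbartRogawski1991 Literature.NumberTheory.GelbartRogawski1991.GRConstruction
open Literature.NumberTheory.GaloisRepresentations
open Literature.NumberTheory.K2Lit.SiegelDoubled
open Summit.HodgeConjecture.HodgeConjecture.Cruxes.HLiu418.K2LiuDoubledUTwoTwoBorelFrame
open Summit.HodgeConjecture.HodgeConjecture.Cruxes.HLiu418.K2LiuKlingenParabolicDefs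
open Summit.HodgeConjecture.HodgeConjecture.Cruxes.HLiu418.K2LiuKlingenUnipotentDefs
open Summit.HodgeConjecture.HodgeConjecture.Cruxes.HLiu418.K2LiuKlingenUnipotentAdelicDefs
open Summit.HodgeConjecture.HodgeConjecture.Cruxes.HLiu418.K2LiuKlingenInnerSectionLeviLaw (apply_transport_weylXi_conj_uPlus_mul)
open Summit.HodgeConjecture.HodgeConjecture.Cruxes.HLiu418.K2LiuSiegelDoubledLeviMatrix (conjAdele_conjAdele')
open UnitaryDualPair

variable {L : Type} [Field L] [NumberField L] [IsCMField L]
variable {N M : ℕ} {e : Fin N × Fin M ≃ Fin 2}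
  {dV : Fin N → L} {hdV : ∀ i, IsCMField.complexConj L (dV i) = dV i}
  {dW : Fin M → L} {hdW : ∀ i, IsCMField.complexConj L (dW i) = dW i}

section Transport

variable {SA : GL (Fin (2 + 2)) (AdeleRing (𝓞 L) L)}
  {Ψ : (quasiSplit (Fp L) L (IsCMField.complexConj L) (2 + 2)).Adelic ≃ₜ* HA L e dV hdV dW hdW} {X Y : Matrix (Fin 2) (Fin 2) (Fp L)} {a : Fp L}
  (hΨ : ∀ g : (quasiSplit (Fp L) L (IsCMField.complexConj L) (2 + 2)).Adelic,
    (((Ψ g : HA L e dV hdV dW hdW) : GL (Fin (2 + 2)) (AdeleRing (𝓞 L) L)) : Matrix (Fin (2 + 2)) (Fin (2 + 2)) (AdeleRing (𝓞 L) L)) =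
      (SA : Matrix (Fin (2 + 2)) (Fin (2 + 2)) (AdeleRing (𝓞 L) L)) *
        ((adelicVal (Fp L) L (IsCMField.complexConj L) (2 + 2) _ g : GL (Fin (2 + 2)) (AdeleRing (𝓞 L) L)) :
          Matrix (Fin (2 + 2)) (Fin (2 + 2)) (AdeleRing (𝓞 L) L)) *
        ((SA⁻¹ : GL (Fin (2 + 2)) (AdeleRing (𝓞 L) L)) : Matrix (Fin (2 + 2)) (Fin (2 + 2)) (AdeleRing (𝓞 L) L)))
  (ha : a + a = 1)
  (hSA : Matrix.reindex (e₂ (n := 2)).symm (e₂ (n := 2)).symm (SA : Matrix (Fin (2 + 2)) (Fin (2 + 2)) (AdeleRing (𝓞 L) L)) =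
    Matrix.fromBlocks (1 : Matrix (Fin 2) (Fin 2) (AdeleRing (𝓞 L) L)) (X.map ((algebraMap L (AdeleRing (𝓞 L) L)).comp (algebraMap (Fp L) L))) 1
      (-(X.map ((algebraMap L (AdeleRing (𝓞 L) L)).comp (algebraMap (Fp L) L)))))
  (hSAi : Matrix.reindex (e₂ (n := 2)).symm (e₂ (n := 2)).symm ((SA⁻¹ : GL (Fin (2 + 2)) (AdeleRing (𝓞 L) L)) : Matrix (Fin (2 + 2)) (Fin (2 + 2)) (AdeleRing (𝓞 L) L)) =
    Matrix.fromBlocks ((a • (1 : Matrix (Fin 2) (Fin 2) (Fp L))).map ((algebraMap L (AdeleRing (𝓞 L) L)).comp (algebraMap (Fp L) L)))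
      ((a • (1 : Matrix (Fin 2) (Fin 2) (Fp L))).map ((algebraMap L (AdeleRing (𝓞 L) L)).comp (algebraMap (Fp L) L)))
      (Y.map ((algebraMap L (AdeleRing (𝓞 L) L)).comp (algebraMap (Fp L) L)))
      (-(Y.map ((algebraMap L (AdeleRing (𝓞 L) L)).comp (algebraMap (Fp L) L)))))
  (hΨP : ∀ b : (quasiSplit (Fp L) L (IsCMField.complexConj L) (2 + 2)).Adelic,
    ((adelicVal (Fp L) L (IsCMField.complexConj L) (2 + 2) _ b : GL (Fin (2 + 2)) (AdeleRing (𝓞 L) L)) :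
        Matrix (Fin (2 + 2)) (Fin (2 + 2)) (AdeleRing (𝓞 L) L)).BlockTriangular id →
      IsSiegelDelta L e dV hdV dW hdW (Ψ b))

include hΨ ha hSA hSAi hΨP in
/-- **(Q2) F5-e — THE `u₊`-INTEGRATION OF THE INNER SECTION OF THE `ξ`-CELL.**  `νN` a measure on `N_Q(𝔸) = klingenUnipA Ψ` with the product structure
`νN = Φ_*(μ_Z × μ)` BY VALUE, where `Φ(z, p) = Ψ(u₊(z)) · Ψ(n_Q(y_p, 0, t_p))` (any measurable coordinate maps `z`, `y_p` skew, `t_p` into `𝔸_L`); `β₁` measurable of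
constant fibre mass `∫⁻ β₁(Φ(z,p)) dμ_Z(z) = C < ∞` (§2: automatic for a `Ψ(u₊(L⁺))`-covering weight); `f` a continuous Siegel section of `I_Δ(s,χ)`; `x ∈ H(𝔸)`; the weighted
integrand integrable.  THEN
  `∫ β₁(u) • f(Ψ(ξ) · u · x) dνN(u) = C · ∫ f(Ψ(ξ) · Ψ(n_Q(y_p, 0, t_p)) · x) dμ(p)`
(`f(Ψ(ξ) Ψ(u₊ z) n′ x) = f(Ψ(ξ u₊(z) ξ⁻¹) · Ψ(ξ) n′ x) = f(Ψ(ξ) n′ x)`, ★ F5-c) — the `hF` of ★ F5-c `klingenInner_levi_law` for `F := C⁻¹ · (∫ β₁ • f(Ψ(ξ) u ·) dνN)`.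
[cite: MoeglinWaldspurger1995, II.1.7] [cite: GanTakeda2011SiegelWeil, §7.2 p. 23] [cite: Weil1965, §9] -/
theorem klingenInner_eq_mul_integral_fibre [MeasurableSpace ↥(klingenUnipA Ψ)] [BorelSpace ↥(klingenUnipA Ψ)] (νN : Measure ↥(klingenUnipA Ψ))
    {Z P : Type*} [MeasurableSpace Z] [MeasurableSpace P] (μZ : Measure Z) (μ : Measure P) [SFinite μZ] [SFinite μ]
    (zf : Z → AdeleRing (𝓞 L) L) (yf : P → AdeleRing (𝓞 L) L) (hyf : ∀ p, conjAdele (Fp L) L (IsCMField.complexConj L) (yf p) = -(yf p)) (tf : P → AdeleRing (𝓞 L) L)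
    (Φ : Z × P → ↥(klingenUnipA Ψ)) (hΦ : Measurable Φ)
    (hΦval : ∀ zp, ((Φ zp : ↥(klingenUnipA Ψ)) : HA L e dV hdV dW hdW) =
      Ψ (jAdelic L 4 (uPlus (AdeleRing (𝓞 L) L) (conjAdele (Fp L) L (IsCMField.complexConj L)) (conjAdele_conjAdele' L) (zf zp.1))) *
        Ψ (jAdelic L 4 (nKlingen (AdeleRing (𝓞 L) L) (conjAdele (Fp L) L (IsCMField.complexConj L)) (conjAdele_conjAdele' L) (yf zp.2) (hyf zp.2) 0 (tf zp.2))))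
    (hνN : νN = (μZ.prod μ).map Φ)
    {β₁ : ↥(klingenUnipA Ψ) → ℝ≥0∞} (hβm : Measurable β₁) {C : ℝ≥0∞} (hC : C ≠ ∞) (hfib : ∀ p, ∫⁻ z, β₁ (Φ (z, p)) ∂μZ = C)
    {χ : HeckeCharacter L} {s : ℂ} {f : HA L e dV hdV dW hdW → ℂ} (hf : IsSiegelDeltaSection L e dV hdV dW hdW χ s f) (hfc : Continuous f)
    (x : HA L e dV hdV dW hdW)
    (hint : Integrable (fun u : ↥(klingenUnipA Ψ) => (β₁ u).toReal •
      f (Ψ (jAdelic L 4 (weylXi (AdeleRing (𝓞 L) L) (conjAdele (Fp L) L (IsCMField.complexConj L)))) * (u : HA L e dV hdV dW hdW) * x)) νN) :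
    ∫ u, (β₁ u).toReal • f (Ψ (jAdelic L 4 (weylXi (AdeleRing (𝓞 L) L) (conjAdele (Fp L) L (IsCMField.complexConj L)))) * (u : HA L e dV hdV dW hdW) * x) ∂νN =
      C.toReal * ∫ p, f (Ψ (jAdelic L 4 (weylXi (AdeleRing (𝓞 L) L) (conjAdele (Fp L) L (IsCMField.complexConj L)))) *
        Ψ (jAdelic L 4 (nKlingen (AdeleRing (𝓞 L) L) (conjAdele (Fp L) L (IsCMField.complexConj L)) (conjAdele_conjAdele' L) (yf p) (hyf p) 0 (tf p))) * x) ∂μ := by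
  refine integral_wt_smul_eq_mul_integral_fibre νN μZ μ Φ hΦ hνN hβm hC hfib
    (φ := fun u : ↥(klingenUnipA Ψ) =>
      f (Ψ (jAdelic L 4 (weylXi (AdeleRing (𝓞 L) L) (conjAdele (Fp L) L (IsCMField.complexConj L)))) * (u : HA L e dV hdV dW hdW) * x))
    ((hfc.comp ((continuous_const.mul continuous_subtype_val).mul continuous_const)).aestronglyMeasurable) _ (fun zp => ?_) hint
  -- invariance along the fibre: `f(Ψξ · Ψ(u₊ z) n′ · x) = f(Ψ(ξ u₊ ξ⁻¹) · (Ψξ n′ x)) = f(Ψξ n′ x)`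
  rw [hΦval zp]
  have hrew : Ψ (jAdelic L 4 (weylXi (AdeleRing (𝓞 L) L) (conjAdele (Fp L) L (IsCMField.complexConj L)))) *
      (Ψ (jAdelic L 4 (uPlus (AdeleRing (𝓞 L) L) (conjAdele (Fp L) L (IsCMField.complexConj L)) (conjAdele_conjAdele' L) (zf zp.1))) *
        Ψ (jAdelic L 4 (nKlingen (AdeleRing (𝓞 L) L) (conjAdele (Fp L) L (IsCMField.complexConj L)) (conjAdele_conjAdele' L) (yf zp.2) (hyf zp.2) 0 (tf zp.2)))) * x =
      Ψ (jAdelic L 4 (weylXi (AdeleRing (𝓞 L) L) (conjAdele (Fp L) L (IsCMField.complexConj L)) *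
          uPlus (AdeleRing (𝓞 L) L) (conjAdele (Fp L) L (IsCMField.complexConj L)) (conjAdele_conjAdele' L) (zf zp.1) *
          (weylXi (AdeleRing (𝓞 L) L) (conjAdele (Fp L) L (IsCMField.complexConj L)))⁻¹)) *
        (Ψ (jAdelic L 4 (weylXi (AdeleRing (𝓞 L) L) (conjAdele (Fp L) L (IsCMField.complexConj L)))) *
          Ψ (jAdelic L 4 (nKlingen (AdeleRing (𝓞 L) L) (conjAdele (Fp L) L (IsCMField.complexConj L)) (conjAdele_conjAdele' L) (yf zp.2) (hyf zp.2) 0 (tf zp.2))) * x) := by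
    rw [map_mul, map_mul, map_mul, map_mul, map_inv, map_inv]
    simp only [mul_assoc, inv_mul_cancel_left]
  rw [hrew]
  exact apply_transport_weylXi_conj_uPlus_mul hΨ ha hSA hSAi hΨP hf (zf zp.1) _

end Transport

end Summit.HodgeConjecture.HodgeConjecture.Cruxes.HLiu418.K2LiuCoveringWeightFibreIntegration

end
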